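import Summits.HodgeConjecture.CorCM.IrreducibleOddWeightsCommutantSchur
import Mathlib.Algebra.BigOperators.Group.Finset.Piecewise
import HarnessLib

/-!
# Density over the commutant, II: D-SPANS AND D-FREE TUPLES — `D⟨b⟩ = Σ_j D·b_j`, maximal D-free sub-tuples span the
# same D-span, and a D-FREE tuple of length `n` has `dim D⟨b⟩ = n · δ`

COR-CM (cell `pub-hodgecm2`, binder seat `b16` gen 72, count-neutral claim DENSITY OVER THE COMMUTANT, file C2 —
pure linear algebra; theorems only, no definition, no named fact, no `sorry`).  NEW as organised here, hence under
`Summits/`.  HONEST FRAMING: «vector spaces over a division ring» (here the commutant `D = 𝒟|_A` of a stable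
irreducible `A`, file C1) written WITHOUT naming the division ring: linear combinations `Σ_j L_j b_j` with `L_j ∈ 𝒟`,
D-FREE tuples (no non-trivial such relation), exchange ∕ maximal free sub-tuples, and the dimension count over `ℚ`
through file I1's complement lemma.  It replaces «linearly independent over `ℚ`» in gen 70's density file I8 by
«free over the commutant»; `HC_CM` is neither used nor asserted; nothing here mentions CM fields.

SETTING (file C1).  `T : ι → End_ℚ(V)`; `A ≤ V` finite-dimensional, stable, irreducible; the commutant is a PARAMETER
`𝒟 ≤ End_ℚ(V)` with `h𝒟 : L ∈ 𝒟 ↔ (L(A) ⊆ A ∧ L T_i = T_i L on A)`; D-lines `D·a = 𝒟.map (applyₗ a)`; `δ = dim D·a₀`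
for any `0 ≠ a₀ ∈ A`.  The D-SPAN of a tuple `b : J → A` is `D⟨b⟩ = ⨆_j D·b_j = {Σ_j L_j b_j : L_j ∈ 𝒟}`; `b` is
D-FREE when `Σ_j L_j b_j = 0`, `L_j ∈ 𝒟` forces every `L_j` to vanish on `A`.

* §1 Scalar commutant: `D·a = ℚa`, `δ = 1`, `D⟨b⟩ = span_ℚ{b_j}` (files I8/I9 are the case `δ = 1`).
* §2 D-spans: membership (`mem_iSup_map_applyₗ_iff`), `D⟨b⟩ ≤ A`, `𝒟`-stability, `span_ℚ{b_j} ≤ D⟨b⟩`, a `𝒟`-stable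
  subspace contains the D-lines of its elements; an operator in `span(T)` killing the `b_j` kills `D⟨b⟩`
  (`apply_eq_zero_of_mem_iSup_map_applyₗ`, since `span(T)` commutes with `𝒟` on `A`).
* §3 **D-FREE TUPLES**: their entries are non-zero; **EXCHANGE** (`exists_free_subfamily`): every tuple in `A` has a
  D-free sub-tuple `b|_S` with `b_j ∈ D⟨b|_S⟩` for all `j` (so `D⟨b⟩ = D⟨b|_S⟩`, `iSup_map_applyₗ_eq_of_forall_mem`);
  **`dim D⟨b⟩ = |J| · δ` for a D-free `b : J → A`** (`finrank_iSup_map_applyₗ_eq_card_mul_of_free`: the D-lines of a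
  free tuple are independent, each of dimension `δ` — file I1's independent spanning subfamily must be all of `J`).
File C3 (`…CommutantDensity`) proves density for D-free tuples and `dim 𝔐(b) · δ = dim D⟨b⟩ · dim A`.

## References

* [Lang2002] S. Lang, *Algebra*, 3rd ed., XVII §1 (modules over a division ring obtained from Schur's lemma), XVII §3.
* [CurtisReiner1962] C. W. Curtis, I. Reiner, *Representation Theory of Finite Groups and Associative Algebras*,
  §27 (27.3).
* [Serre1977] J.-P. Serre, *Linear Representations of Finite Groups*, GTM 42, §2.2.
-/

set_option autoImplicit false

noncomputable section

open scoped BigOperators Classical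

universe u v w

namespace Summit.HodgeConjecture.CorCM.IrrOdd

variable {V : Type v} [AddCommGroup V] [Module ℚ V] {ι : Type w} (T : ι → V →ₗ[ℚ] V)

/-! ### §1 The D-line of `0`; scalar commutant -/

omit [AddCommGroup V] [Module ℚ V] in
/-- The D-line of `0` is `0`. [folklore] -/
theorem map_applyₗ_zero [AddCommGroup V] [Module ℚ V] (𝒟 : Submodule ℚ (V →ₗ[ℚ] V)) :
    𝒟.map (LinearMap.applyₗ (0 : V)) = ⊥ := by
  rw [eq_bot_iff]
  rintro _ ⟨L, -, rfl⟩
  rw [Submodule.mem_bot, LinearMap.applyₗ_apply_apply, map_zero]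

/-- **SCALAR COMMUTANT ⟹ `D·a = ℚa`** (the case of files I8/I9). [cite: Lang2002, XVII §3] -/
theorem map_applyₗ_eq_span_singleton_of_scalar {𝒟 : Submodule ℚ (V →ₗ[ℚ] V)} {A : Submodule ℚ V}
    (h𝒟 : ∀ L : V →ₗ[ℚ] V, L ∈ 𝒟 ↔ (∀ a ∈ A, L a ∈ A) ∧ ∀ (i : ι) (a : V), a ∈ A → L (T i a) = T i (L a))
    (hsc : ∀ L : V →ₗ[ℚ] V, (∀ a ∈ A, L a ∈ A) → (∀ (i : ι) (a : V), a ∈ A → L (T i a) = T i (L a)) →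
      ∃ c : ℚ, ∀ a ∈ A, L a = c • a)
    {a : V} (ha : a ∈ A) : 𝒟.map (LinearMap.applyₗ a) = ℚ ∙ a := by
  refine le_antisymm ?_ ((Submodule.span_singleton_le_iff_mem a _).2 (self_mem_map_applyₗ T h𝒟 a))
  rintro _ ⟨L, hL, rfl⟩
  obtain ⟨c, hc⟩ := hsc L ((h𝒟 L).1 hL).1 ((h𝒟 L).1 hL).2
  exact Submodule.mem_span_singleton.2 ⟨c, by rw [LinearMap.applyₗ_apply_apply, hc a ha]⟩

/-- Scalar commutant ⟹ `δ = 1`. [cite: Lang2002, XVII §3] -/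
theorem finrank_map_applyₗ_eq_one_of_scalar {𝒟 : Submodule ℚ (V →ₗ[ℚ] V)} {A : Submodule ℚ V}
    (h𝒟 : ∀ L : V →ₗ[ℚ] V, L ∈ 𝒟 ↔ (∀ a ∈ A, L a ∈ A) ∧ ∀ (i : ι) (a : V), a ∈ A → L (T i a) = T i (L a))
    (hsc : ∀ L : V →ₗ[ℚ] V, (∀ a ∈ A, L a ∈ A) → (∀ (i : ι) (a : V), a ∈ A → L (T i a) = T i (L a)) →
      ∃ c : ℚ, ∀ a ∈ A, L a = c • a)
    {a : V} (ha : a ∈ A) (ha0 : a ≠ 0) : Module.finrank ℚ ↥(𝒟.map (LinearMap.applyₗ a)) = 1 := by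
  rw [map_applyₗ_eq_span_singleton_of_scalar T h𝒟 hsc ha, finrank_span_singleton ha0]

/-- Scalar commutant ⟹ **`D⟨b⟩ = span_ℚ{b_j}`**. [cite: Lang2002, XVII §3] -/
theorem iSup_map_applyₗ_eq_span_range_of_scalar {𝒟 : Submodule ℚ (V →ₗ[ℚ] V)} {A : Submodule ℚ V}
    (h𝒟 : ∀ L : V →ₗ[ℚ] V, L ∈ 𝒟 ↔ (∀ a ∈ A, L a ∈ A) ∧ ∀ (i : ι) (a : V), a ∈ A → L (T i a) = T i (L a))
    (hsc : ∀ L : V →ₗ[ℚ] V, (∀ a ∈ A, L a ∈ A) → (∀ (i : ι) (a : V), a ∈ A → L (T i a) = T i (L a)) →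
      ∃ c : ℚ, ∀ a ∈ A, L a = c • a)
    {J : Type u} {b : J → V} (hb : ∀ j, b j ∈ A) :
    (⨆ j, 𝒟.map (LinearMap.applyₗ (b j))) = Submodule.span ℚ (Set.range b) := by
  rw [Submodule.span_range_eq_iSup]
  exact iSup_congr fun j => map_applyₗ_eq_span_singleton_of_scalar T h𝒟 hsc (hb j)

/-! ### §2 D-spans -/

/-- **MEMBERSHIP IN A D-SPAN**: `v ∈ D⟨b⟩ ⟺ v = Σ_j L_j b_j` with all `L_j ∈ 𝒟` (`J` finite).
[cite: Lang2002, XVII §1] -/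
theorem mem_iSup_map_applyₗ_iff (𝒟 : Submodule ℚ (V →ₗ[ℚ] V)) {J : Type u} [Fintype J] (b : J → V) (v : V) :
    (v ∈ ⨆ j, 𝒟.map (LinearMap.applyₗ (b j))) ↔
      ∃ L : J → (V →ₗ[ℚ] V), (∀ j, L j ∈ 𝒟) ∧ ∑ j, L j (b j) = v := by
  constructor
  · intro hv
    refine Submodule.iSup_induction (fun j => 𝒟.map (LinearMap.applyₗ (b j)))
      (motive := fun v => ∃ L : J → (V →ₗ[ℚ] V), (∀ j, L j ∈ 𝒟) ∧ ∑ j, L j (b j) = v) hv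
      (fun i v hv => ?_) ⟨0, fun _ => Submodule.zero_mem _, by simp⟩ (fun v v' hv hv' => ?_)
    · obtain ⟨L₀, hL₀, rfl⟩ := (mem_map_applyₗ_iff 𝒟 (b i) v).1 hv
      refine ⟨Pi.single i L₀, fun j => ?_, ?_⟩
      · by_cases hj : j = i
        · subst hj; rw [Pi.single_eq_same]; exact hL₀
        · rw [Pi.single_eq_of_ne hj]; exact Submodule.zero_mem _
      · rw [Finset.sum_eq_single i (fun j _ hj => by rw [Pi.single_eq_of_ne hj, LinearMap.zero_apply])
          (fun h => absurd (Finset.mem_univ i) h), Pi.single_eq_same]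
    · obtain ⟨L, hL, rfl⟩ := hv
      obtain ⟨L', hL', rfl⟩ := hv'
      exact ⟨L + L', fun j => Submodule.add_mem _ (hL j) (hL' j), by
        rw [← Finset.sum_add_distrib]; rfl⟩
  · rintro ⟨L, hL, rfl⟩
    exact Submodule.sum_mem _ fun j _ => Submodule.mem_iSup_of_mem j ⟨L j, hL j, rfl⟩

/-- D-spans of tuples in `A` lie in `A`. [cite: Lang2002, XVII §1] -/
theorem iSup_map_applyₗ_le {𝒟 : Submodule ℚ (V →ₗ[ℚ] V)} {A : Submodule ℚ V}
    (h𝒟 : ∀ L : V →ₗ[ℚ] V, L ∈ 𝒟 ↔ (∀ a ∈ A, L a ∈ A) ∧ ∀ (i : ι) (a : V), a ∈ A → L (T i a) = T i (L a))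
    {J : Type u} {b : J → V} (hb : ∀ j, b j ∈ A) : (⨆ j, 𝒟.map (LinearMap.applyₗ (b j))) ≤ A :=
  iSup_le fun j => map_applyₗ_le T h𝒟 (hb j)

/-- D-spans are `𝒟`-stable (`J` finite). [cite: Lang2002, XVII §1] -/
theorem iSup_map_applyₗ_stable {𝒟 : Submodule ℚ (V →ₗ[ℚ] V)} {A : Submodule ℚ V}
    (h𝒟 : ∀ L : V →ₗ[ℚ] V, L ∈ 𝒟 ↔ (∀ a ∈ A, L a ∈ A) ∧ ∀ (i : ι) (a : V), a ∈ A → L (T i a) = T i (L a))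
    {J : Type u} [Fintype J] (b : J → V) :
    ∀ (L : ↥𝒟) (v : V), (v ∈ ⨆ j, 𝒟.map (LinearMap.applyₗ (b j))) →
      (L : V →ₗ[ℚ] V) v ∈ ⨆ j, 𝒟.map (LinearMap.applyₗ (b j)) :=
  stable_iSup (fun L : ↥𝒟 => (L : V →ₗ[ℚ] V)) _ fun j => map_applyₗ_stable T h𝒟 (b j)

/-- `b_j ∈ D⟨b⟩`. [folklore] -/
theorem apply_mem_iSup_map_applyₗ {𝒟 : Submodule ℚ (V →ₗ[ℚ] V)} {A : Submodule ℚ V}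
    (h𝒟 : ∀ L : V →ₗ[ℚ] V, L ∈ 𝒟 ↔ (∀ a ∈ A, L a ∈ A) ∧ ∀ (i : ι) (a : V), a ∈ A → L (T i a) = T i (L a))
    {J : Type u} (b : J → V) (j : J) : b j ∈ ⨆ j, 𝒟.map (LinearMap.applyₗ (b j)) :=
  Submodule.mem_iSup_of_mem j (self_mem_map_applyₗ T h𝒟 (b j))

/-- `span_ℚ{b_j} ≤ D⟨b⟩`. [folklore] -/
theorem span_range_le_iSup_map_applyₗ {𝒟 : Submodule ℚ (V →ₗ[ℚ] V)} {A : Submodule ℚ V}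
    (h𝒟 : ∀ L : V →ₗ[ℚ] V, L ∈ 𝒟 ↔ (∀ a ∈ A, L a ∈ A) ∧ ∀ (i : ι) (a : V), a ∈ A → L (T i a) = T i (L a))
    {J : Type u} (b : J → V) : Submodule.span ℚ (Set.range b) ≤ ⨆ j, 𝒟.map (LinearMap.applyₗ (b j)) := by
  rw [Submodule.span_le]
  rintro _ ⟨j, rfl⟩
  exact apply_mem_iSup_map_applyₗ T h𝒟 b j

omit [AddCommGroup V] [Module ℚ V] in
/-- A `𝒟`-stable subspace contains the D-lines of its elements. [cite: Lang2002, XVII §1] -/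
theorem map_applyₗ_le_of_mem [AddCommGroup V] [Module ℚ V] {𝒟 : Submodule ℚ (V →ₗ[ℚ] V)} {W : Submodule ℚ V}
    (hWst : ∀ (L : ↥𝒟) (v : V), v ∈ W → (L : V →ₗ[ℚ] V) v ∈ W) {v : V} (hv : v ∈ W) :
    𝒟.map (LinearMap.applyₗ v) ≤ W := by
  rintro _ ⟨L, hL, rfl⟩
  exact hWst ⟨L, hL⟩ v hv

/-- **`D⟨b⟩ = D⟨b|_S⟩` when every `b_j` lies in `D⟨b|_S⟩`** (`S ⊆ J`). [cite: Lang2002, XVII §1] -/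
theorem iSup_map_applyₗ_eq_of_forall_mem {𝒟 : Submodule ℚ (V →ₗ[ℚ] V)} {A : Submodule ℚ V}
    (h𝒟 : ∀ L : V →ₗ[ℚ] V, L ∈ 𝒟 ↔ (∀ a ∈ A, L a ∈ A) ∧ ∀ (i : ι) (a : V), a ∈ A → L (T i a) = T i (L a))
    {J : Type u} (b : J → V) (S : Finset J)
    (hS : ∀ j, b j ∈ ⨆ k : ↥S, 𝒟.map (LinearMap.applyₗ (b k))) :
    (⨆ j, 𝒟.map (LinearMap.applyₗ (b j))) = ⨆ k : ↥S, 𝒟.map (LinearMap.applyₗ (b k)) := by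
  refine le_antisymm (iSup_le fun j => map_applyₗ_le_of_mem ?_ (hS j))
    (iSup_le fun k => le_iSup (fun j => 𝒟.map (LinearMap.applyₗ (b j))) (k : J))
  exact iSup_map_applyₗ_stable T h𝒟 fun k : ↥S => b k

/-- **AN OPERATOR IN `span(T)` KILLING THE `b_j` KILLS `D⟨b⟩`** (`b_j ∈ A`; `span(T)` commutes with `𝒟` on `A`).
[cite: Lang2002, XVII §3] -/
theorem apply_eq_zero_of_mem_iSup_map_applyₗ {𝒟 : Submodule ℚ (V →ₗ[ℚ] V)} {A : Submodule ℚ V}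
    (h𝒟 : ∀ L : V →ₗ[ℚ] V, L ∈ 𝒟 ↔ (∀ a ∈ A, L a ∈ A) ∧ ∀ (i : ι) (a : V), a ∈ A → L (T i a) = T i (L a))
    {φ : V →ₗ[ℚ] V} (hφ : φ ∈ Submodule.span ℚ (Set.range T)) {J : Type u} {b : J → V} (hb : ∀ j, b j ∈ A)
    (h0 : ∀ j, φ (b j) = 0) {v : V} (hv : v ∈ ⨆ j, 𝒟.map (LinearMap.applyₗ (b j))) : φ v = 0 := by
  refine Submodule.iSup_induction (fun j => 𝒟.map (LinearMap.applyₗ (b j))) (motive := fun v => φ v = 0) hv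
    (fun j v hv => ?_) (map_zero φ) (fun v v' hv hv' => by rw [map_add, hv, hv', add_zero])
  obtain ⟨L, hL, rfl⟩ := (mem_map_applyₗ_iff 𝒟 (b j) v).1 hv
  rw [← commutant_apply_comm_of_mem_span_range T h𝒟 hL hφ (hb j), h0 j, map_zero]

/-! ### §3 D-free tuples -/

/-- The entries of a D-free tuple are non-zero (when `A ≠ 0`; `id ∈ 𝒟`). [cite: Lang2002, XVII §1] -/
theorem ne_zero_of_free {𝒟 : Submodule ℚ (V →ₗ[ℚ] V)} {A : Submodule ℚ V}
    (h𝒟 : ∀ L : V →ₗ[ℚ] V, L ∈ 𝒟 ↔ (∀ a ∈ A, L a ∈ A) ∧ ∀ (i : ι) (a : V), a ∈ A → L (T i a) = T i (L a))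
    (hA : A ≠ ⊥) {J : Type u} [Fintype J] {b : J → V}
    (hfree : ∀ L : J → (V →ₗ[ℚ] V), (∀ j, L j ∈ 𝒟) → ∑ j, L j (b j) = 0 → ∀ (j : J) (a : V), a ∈ A → L j a = 0)
    (j : J) : b j ≠ 0 := by
  intro hj
  obtain ⟨a, ha, ha0⟩ := Submodule.exists_mem_ne_zero_of_ne_bot hA
  refine ha0 (hfree (Pi.single j LinearMap.id) (fun j' => ?_) ?_ j a ha ▸ ?_)
  · by_cases h : j' = j
    · subst h; rw [Pi.single_eq_same]; exact commutant_id_mem T h𝒟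
    · rw [Pi.single_eq_of_ne h]; exact Submodule.zero_mem _
  · rw [Finset.sum_eq_single j (fun j' _ hj' => by rw [Pi.single_eq_of_ne hj', LinearMap.zero_apply])
      (fun h => absurd (Finset.mem_univ j) h), Pi.single_eq_same, LinearMap.id_apply, hj]
  · rw [Pi.single_eq_same, LinearMap.id_apply]

/-- **EXCHANGE: A MAXIMAL D-FREE SUB-TUPLE SPANS THE D-SPAN.**  Every tuple `b : J → A` (`J` finite, `A`
finite-dimensional stable irreducible) has a sub-tuple `b|_S` which is D-FREE and with `b_j ∈ D⟨b|_S⟩` for every `j`: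
take `S` D-free of maximal size; for `t ∉ S` a relation on `S ∪ {t}` has an INVERTIBLE coefficient at `t` (file C1,
Schur), which solves for `b_t`. [cite: Lang2002, XVII §1] [cite: CurtisReiner1962, §27 (27.3)] -/
theorem exists_free_subfamily {𝒟 : Submodule ℚ (V →ₗ[ℚ] V)} {A : Submodule ℚ V} [FiniteDimensional ℚ A]
    (h𝒟 : ∀ L : V →ₗ[ℚ] V, L ∈ 𝒟 ↔ (∀ a ∈ A, L a ∈ A) ∧ ∀ (i : ι) (a : V), a ∈ A → L (T i a) = T i (L a))
    (hAst : ∀ (i : ι) (v : V), v ∈ A → T i v ∈ A)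
    (hAirr : ∀ W : Submodule ℚ V, W ≤ A → W ≠ ⊥ → (∀ (i : ι) (v : V), v ∈ W → T i v ∈ W) → W = A)
    {J : Type u} [Fintype J] {b : J → V} (hb : ∀ j, b j ∈ A) :
    ∃ S : Finset J,
      (∀ L : ↥S → (V →ₗ[ℚ] V), (∀ k, L k ∈ 𝒟) → ∑ k, L k (b k) = 0 →
        ∀ (k : ↥S) (a : V), a ∈ A → L k a = 0) ∧
      ∀ j, b j ∈ ⨆ k : ↥S, 𝒟.map (LinearMap.applyₗ (b k)) := by
  -- D-free finsets, in the `Finset.sum` form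
  set adm : Finset (Finset J) := Finset.univ.filter fun S : Finset J =>
    ∀ L : J → (V →ₗ[ℚ] V), (∀ j, L j ∈ 𝒟) → ∑ j ∈ S, L j (b j) = 0 → ∀ j ∈ S, ∀ a ∈ A, L j a = 0 with hadm
  have hmem_adm : ∀ S : Finset J, S ∈ adm ↔
      ∀ L : J → (V →ₗ[ℚ] V), (∀ j, L j ∈ 𝒟) → ∑ j ∈ S, L j (b j) = 0 → ∀ j ∈ S, ∀ a ∈ A, L j a = 0 := fun S => by
    rw [hadm, Finset.mem_filter]
    simp
  have h0 : (∅ : Finset J) ∈ adm := (hmem_adm ∅).2 fun L _ _ j hj => absurd hj (Finset.notMem_empty j)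
  obtain ⟨S, hS, hmax⟩ := Finset.exists_max_image adm Finset.card ⟨∅, h0⟩
  have hSfree := (hmem_adm S).1 hS
  refine ⟨S, fun L hL hsum k a ha => ?_, fun t => ?_⟩
  · -- the subtype form of D-freeness from the `Finset.sum` form: extend `L` by zero
    have hext : ∀ j, (fun j => if h : j ∈ S then L ⟨j, h⟩ else 0) j ∈ 𝒟 := fun j => by
      by_cases h : j ∈ S
      · simp only [h, dite_true]; exact hL ⟨j, h⟩
      · simp only [h, dite_false]; exact Submodule.zero_mem _
    have hsum' : ∑ j ∈ S, (fun j => if h : j ∈ S then L ⟨j, h⟩ else (0 : V →ₗ[ℚ] V)) j (b j) = 0 := by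
      rw [← Finset.sum_coe_sort]
      rw [← hsum]
      refine Finset.sum_congr rfl fun k _ => ?_
      simp only [k.2, dite_true]
    have h := hSfree _ hext hsum' k k.2 a ha
    simpa only [k.2, dite_true] using h
  · by_contra ht
    have htS : t ∉ S := fun htS => ht (Submodule.mem_iSup_of_mem ⟨t, htS⟩ (self_mem_map_applyₗ T h𝒟 (b t)))
    -- `insert t S` is D-free, contradicting maximality
    have hins : insert t S ∈ adm := by
      refine (hmem_adm _).2 fun L hL hsum => ?_
      rw [Finset.sum_insert htS] at hsum
      by_cases hLt : ∀ a ∈ A, L t a = 0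
      · rw [hLt _ (hb t), zero_add] at hsum
        intro j hj a ha
        rcases Finset.mem_insert.1 hj with rfl | hj
        · exact hLt a ha
        · exact hSfree L hL hsum j hj a ha
      · -- an invertible coefficient at `t` solves for `b t`
        exfalso
        obtain ⟨L', hL', -, hlinv, -⟩ := exists_commutant_inverse T h𝒟 hAst hAirr (hL t) hLt
        apply ht
        have hbt : b t = -(L' (∑ j ∈ S, L j (b j))) := by
          rw [← hlinv (b t) (hb t), eq_neg_iff_add_eq_zero, ← map_add, hsum, map_zero]
        rw [hbt, map_sum]
        refine Submodule.neg_mem _ (Submodule.sum_mem _ fun j hj => ?_)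
        exact Submodule.mem_iSup_of_mem ⟨j, hj⟩ ⟨L' ∘ₗ L j, commutant_comp_mem T h𝒟 hL' (hL j), rfl⟩
    have hcard := hmax _ hins
    rw [Finset.card_insert_of_notMem htS] at hcard
    omega

/-- **A D-FREE TUPLE OF LENGTH `n` SPANS A D-SPAN OF DIMENSION `n · δ`** (`A` finite-dimensional stable irreducible,
`T` closed under composition with identity, `0 ≠ a₀ ∈ A`): the D-lines `D·b_j` are `𝒟`-stable irreducible of
dimension `δ` and, `b` being D-free, file I1's independent spanning subfamily is all of `J`.
[cite: Lang2002, XVII §1] [cite: CurtisReiner1962, §27 (27.3)] -/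
theorem finrank_iSup_map_applyₗ_eq_card_mul_of_free {𝒟 : Submodule ℚ (V →ₗ[ℚ] V)} {A : Submodule ℚ V}
    [FiniteDimensional ℚ A]
    (h𝒟 : ∀ L : V →ₗ[ℚ] V, L ∈ 𝒟 ↔ (∀ a ∈ A, L a ∈ A) ∧ ∀ (i : ι) (a : V), a ∈ A → L (T i a) = T i (L a))
    (h1 : ∃ i₀ : ι, T i₀ = LinearMap.id) (hmul : ∀ i i' : ι, ∃ i'' : ι, T i'' = T i ∘ₗ T i')
    (hAst : ∀ (i : ι) (v : V), v ∈ A → T i v ∈ A)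
    (hAirr : ∀ W : Submodule ℚ V, W ≤ A → W ≠ ⊥ → (∀ (i : ι) (v : V), v ∈ W → T i v ∈ W) → W = A)
    {J : Type u} [Fintype J] {b : J → V} (hb : ∀ j, b j ∈ A)
    (hfree : ∀ L : J → (V →ₗ[ℚ] V), (∀ j, L j ∈ 𝒟) → ∑ j, L j (b j) = 0 → ∀ (j : J) (a : V), a ∈ A → L j a = 0)
    {a₀ : V} (ha₀ : a₀ ∈ A) (h0 : a₀ ≠ 0) :
    Module.finrank ℚ ↥(⨆ j, 𝒟.map (LinearMap.applyₗ (b j))) =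
      Fintype.card J * Module.finrank ℚ ↥(𝒟.map (LinearMap.applyₗ a₀)) := by
  have hA : A ≠ ⊥ := fun h => h0 ((Submodule.mem_bot ℚ).1 (h ▸ ha₀))
  let N : J → Submodule ℚ V := fun j => 𝒟.map (LinearMap.applyₗ (b j))
  haveI : ∀ j, FiniteDimensional ℚ (N j) := fun j =>
    Submodule.finiteDimensional_of_le (map_applyₗ_le T h𝒟 (hb j))
  have hNst : ∀ (j : J) (L : ↥𝒟) (v : V), v ∈ N j → (L : V →ₗ[ℚ] V) v ∈ N j :=
    fun j => map_applyₗ_stable T h𝒟 (b j)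
  have hNirr : ∀ (j : J) (W : Submodule ℚ V), W ≤ N j → W ≠ ⊥ →
      (∀ (L : ↥𝒟) (v : V), v ∈ W → (L : V →ₗ[ℚ] V) v ∈ W) → W = N j :=
    fun j => map_applyₗ_irreducible T h𝒟 hAst hAirr (hb j)
  obtain ⟨S, hsup, hdim⟩ := exists_finset_sup_eq_iSup_finrank_eq_sum (fun L : ↥𝒟 => (L : V →ₗ[ℚ] V)) hNst hNirr
  -- `S` is all of `J`: a missing `t` would give the relation `b_t - Σ_{j∈S} L_j b_j = 0` with coefficient `id` at `t`
  have hS : S = Finset.univ := by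
    by_contra hne
    obtain ⟨t, -, htS⟩ := Finset.exists_of_ssubset (lt_of_le_of_ne (Finset.subset_univ S) hne)
    have hbt : b t ∈ ⨆ j ∈ S, N j := by
      rw [← Finset.sup_eq_iSup, hsup]
      exact Submodule.mem_iSup_of_mem t (self_mem_map_applyₗ T h𝒟 (b t))
    obtain ⟨μ, hμ⟩ := (Submodule.mem_iSup_finset_iff_exists_sum N (b t)).1 hbt
    have hμL : ∀ j, ∃ L ∈ 𝒟, L (b j) = (μ j : V) := fun j => (mem_map_applyₗ_iff 𝒟 (b j) _).1 (μ j).2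
    choose L hL hLb using hμL
    -- the relation `Σ_{j∈S} L_j b_j - b_t = 0`, coefficient `-id` at `t`
    let L' : J → (V →ₗ[ℚ] V) := fun j =>
      (if j ∈ S then L j else 0) - (if j = t then LinearMap.id else 0)
    have hL'b : ∀ j, L' j (b j) = (if j ∈ S then (μ j : V) else 0) - (if j = t then b j else 0) := fun j => by
      simp only [L', LinearMap.sub_apply]
      congr 1
      · split_ifs
        · exact hLb j
        · rfl
      · split_ifs
        · rfl
        · rfl
    have hrel : ∑ j, L' j (b j) = 0 := by
      simp only [hL'b, Finset.sum_sub_distrib, Finset.sum_ite_mem, Finset.univ_inter, Finset.sum_ite_eq',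
        Finset.mem_univ, if_true, hμ, sub_self]
    have hmemD : ∀ j, L' j ∈ 𝒟 := fun j => by
      refine Submodule.sub_mem _ ?_ ?_
      · split_ifs
        · exact hL j
        · exact Submodule.zero_mem _
      · split_ifs
        · exact commutant_id_mem T h𝒟
        · exact Submodule.zero_mem _
    have hzero := hfree L' hmemD hrel t
    have hid : ∀ a ∈ A, a = 0 := fun a ha => by
      have h := hzero a ha
      simp only [L', htS, if_false, if_true, zero_sub, LinearMap.neg_apply, LinearMap.id_apply,
        neg_eq_zero] at h
      exact h
    exact hA ((Submodule.eq_bot_iff A).2 hid)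
  have hδ : ∀ j, Module.finrank ℚ (N j) = Module.finrank ℚ ↥(𝒟.map (LinearMap.applyₗ a₀)) := fun j =>
    finrank_map_applyₗ_eq T h𝒟 h1 hmul hAst hAirr (hb j) (ne_zero_of_free T h𝒟 hA hfree j) ha₀ h0
  rw [hdim, hS]
  simp only [hδ]
  rw [Finset.sum_const, Finset.card_univ, smul_eq_mul]

end Summit.HodgeConjecture.CorCM.IrrOdd

end
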